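import Summits.Ventures.CertifiedManyBodySolver.Downfold.EmeryZoneWeightShellBound
import Summits.Ventures.CertifiedManyBodySolver.Downfold.EmeryZoneOrbitalContentCheck
import Mathlib.Data.Rat.Floor
import HarnessLib

/-!
# THE ORBITAL PARTITION OF THE HOLES OVER THE ZONE, III: energy shells, integerised Möbius weights, the per-cell weight enclosure

Venture CertifiedManyBodySolver, cell `pub/hubbard-downfold` (stage S1; INFLATION-RULES-3to1-B §B.81), seat hubbard-downfold-mod-4
(technique B, g33); namespace `Summit.Ventures.CertifiedManyBodySolver.Downfold.Emery`. Everything PROVED (0 sorry). WHAT THIS IS NOT: a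
statement about any material; `U = 0` one-body kinematics of the σ model.

* §4 ENERGY SHELLS `[E, E + h]`: the exact shell quantities of `EmeryZoneWeightShellBound` are CHECKED in `ℚ` (`shellOK`: `Dlo > 0`,
  `C(E) ≥ 0`, `E > 0`, `fsT > 0` on the shell by a Taylor bound, integrality at the common denominator `shellL`) and integerised
  (`shellZ`; `δ` rounded UP to the weight scale `W = 10⁵`). **`abWeightK_mem_shell`**: at a zone point whose band energy lies in the shell
  and whose harmonic `s = x + y − 2xy` lies in `[σa, σb] ⊆ [0, 1]`, the Cu weight satisfies `N/D(E, σa) − δ ≤ w_d(k) ≤ N/D(E, σb) + δ`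
  (harmonic law `dWeight_eq_harmonic` + `abs_w_sub_le_delta` + `w_mono_s`); integer forms `wLoZ_sound`, `wHiZ_sound` (floor / ceiling
  of the scaled Möbius value; the common factor cancels).
* §5 (file `EmeryZoneOrbitalContentCells`): per coarse cell — harmonic range, shell index range, clipped weights.

Sources: [HybertsenSchluterChristensen1989, Eq. (1)]; [AndersenEtAl1995, §6]; interval arithmetic [folklore] (Moore 1966).
-/

namespace Summit.Ventures.CertifiedManyBodySolver.Downfold.Emery

open Real Set

/-! ## §4 Shells: checks, integer data, and the weight enclosure at a hole point -/

/-- Integer shell data: `(n₀, n₁, d₀, d₁)·L` (common denominator) and `δ` rounded up to the weight scale. [folklore] -/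
structure ShellZ where
  /-- `L·N₀(E)` -/
  n0 : ℤ
  /-- `L·N₁(E)` -/
  n1 : ℤ
  /-- `L·D₀(E)` -/
  d0 : ℤ
  /-- `L·D₁(E)` -/
  d1 : ℤ
  /-- `⌈W·δ(E, h)⌉` -/
  dl : ℤ

/-- The common denominator of the four shell values. [folklore] -/
def shellL (Δ a b c E : ℚ) : ℕ :=
  Nat.lcm (Nat.lcm ((sN0 Δ a b c).eval E).den ((sN1 Δ a b c).eval E).den)
    (Nat.lcm ((sD0 Δ a b c).eval E).den ((sD1 Δ a b c).eval E).den)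

/-- Integerised shell data. [folklore] -/
def shellZ (Δ a b c E h : ℚ) : ShellZ where
  n0 := ((sN0 Δ a b c).eval E * shellL Δ a b c E).num
  n1 := ((sN1 Δ a b c).eval E * shellL Δ a b c E).num
  d0 := ((sD0 Δ a b c).eval E * shellL Δ a b c E).num
  d1 := ((sD1 Δ a b c).eval E * shellL Δ a b c E).num
  dl := ⌈shellDelta Δ a b c E h * wW⌉

/-- Shell admissibility: `Dlo > 0`, `C ≥ 0`, `E > 0`, `fsT > 0` on `[E, E + h]`, integrality of the four scaled values. [folklore] -/
def shellOK (Δ a b c E h : ℚ) : Bool :=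
  decide (0 < shellDlo Δ a b c E h) && decide (0 ≤ crossC Δ a b c E) && decide (0 < E) &&
  decide (0 < ((sFsT Δ a b c).shift E).c0 - ((sFsT Δ a b c).shift E).absTail h) &&
  decide (((sN0 Δ a b c).eval E * shellL Δ a b c E).den = 1) && decide (((sN1 Δ a b c).eval E * shellL Δ a b c E).den = 1) &&
  decide (((sD0 Δ a b c).eval E * shellL Δ a b c E).den = 1) && decide (((sD1 Δ a b c).eval E * shellL Δ a b c E).den = 1) &&
  decide (0 < shellL Δ a b c E)

/-- Floored Möbius value at `s = S/10⁹` minus `δ`, at scale `W`. [folklore] -/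
def wLoZ (sh : ShellZ) (S : ℤ) : ℤ := (sh.n0 * gN + S * sh.n1) * wW / (sh.d0 * gN + S * sh.d1) - sh.dl

/-- Ceiled Möbius value at `s = S/10⁹` plus `δ`, at scale `W`. [folklore] -/
def wHiZ (sh : ShellZ) (S : ℤ) : ℤ := -((-((sh.n0 * gN + S * sh.n1) * wW)) / (sh.d0 * gN + S * sh.d1)) + sh.dl

/-- `fsT > 0` on the shell from the Taylor check. [folklore] -/
theorem fsT_pos_of_shift {Δ a b c E h : ℚ} (hF : 0 < ((sFsT Δ a b c).shift E).c0 - ((sFsT Δ a b c).shift E).absTail h)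
    {t : ℝ} (ht : 0 ≤ t) (hth : t ≤ h) : 0 < fsT (Δ : ℝ) a b c (E + t) := by
  have hF' := (Rat.cast_lt (K := ℝ)).2 hF
  push_cast at hF'
  have e0 : ((((sFsT Δ a b c).shift E).c0 : ℚ) : ℝ) = ((sFsT (Δ : ℝ) a b c).shift (E : ℝ)).c0 := by
    rw [Sext.shift_c0, Sext.shift_c0, Sext.cast_eval, map_sFsT]
  have e1 : ((((sFsT Δ a b c).shift E).absTail h : ℚ) : ℝ) = ((sFsT (Δ : ℝ) a b c).shift (E : ℝ)).absTail (h : ℝ) := by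
    rw [Sext.cast_absTail, Sext.map_shift, map_sFsT]
  rw [e0, e1] at hF'
  rw [← eval_sFsT, ← Sext.eval_shift]
  have hb := Sext.abs_eval_sub_le_absTail ((sFsT (Δ : ℝ) a b c).shift (E : ℝ)) ht hth
  rw [abs_le] at hb
  linarith [hb.1]

/-- What `shellOK` gives on the real side. [folklore] -/
theorem shellOK_spec {Δ a b c E h : ℚ} (hs : shellOK Δ a b c E h = true) :
    0 < shellDlo (Δ : ℝ) a b c E h ∧ 0 ≤ crossC (Δ : ℝ) a b c E ∧ (0 : ℝ) < E ∧
    0 < ((sFsT Δ a b c).shift E).c0 - ((sFsT Δ a b c).shift E).absTail h ∧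
    ((shellZ Δ a b c E h).n0 : ℝ) = ((sN0 (Δ : ℝ) a b c).eval (E : ℝ)) * shellL Δ a b c E ∧
    ((shellZ Δ a b c E h).n1 : ℝ) = ((sN1 (Δ : ℝ) a b c).eval (E : ℝ)) * shellL Δ a b c E ∧
    ((shellZ Δ a b c E h).d0 : ℝ) = ((sD0 (Δ : ℝ) a b c).eval (E : ℝ)) * shellL Δ a b c E ∧
    ((shellZ Δ a b c E h).d1 : ℝ) = ((sD1 (Δ : ℝ) a b c).eval (E : ℝ)) * shellL Δ a b c E ∧
    0 < shellL Δ a b c E := by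
  simp only [shellOK, Bool.and_eq_true, decide_eq_true_eq] at hs
  obtain ⟨⟨⟨⟨⟨⟨⟨⟨h1, h2⟩, h3⟩, h4⟩, h5⟩, h6⟩, h7⟩, h8⟩, h9⟩ := hs
  refine ⟨by rw [← cast_shellDlo]; exact_mod_cast h1, by rw [← cast_crossC]; exact_mod_cast h2, by exact_mod_cast h3, h4, ?_, ?_, ?_, ?_, h9⟩
  · simp only [shellZ]; rw [num_cast_of_den h5, Sext.cast_eval, map_sN0]
  · simp only [shellZ]; rw [num_cast_of_den h6, Sext.cast_eval, map_sN1]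
  · simp only [shellZ]; rw [num_cast_of_den h7, Sext.cast_eval, map_sD0]
  · simp only [shellZ]; rw [num_cast_of_den h8, Sext.cast_eval, map_sD1]

/-- **THE WEIGHT ENCLOSURE AT A HOLE POINT.** For a σ set with `Δ ≥ 0`, `0 ≤ t_pp′ ≤ t_pp`, `t_pd > 0`, an admissible shell `[E, E + h]`
and a zone point `k` with `E ≤ ε_AB(k) ≤ E + h` whose harmonic lies in `[σa, σb] ⊆ [0, 1]`:
`N/D(E, σa) − δ ≤ w_d(k) ≤ N/D(E, σb) + δ`. [folklore] -/
theorem abWeightK_mem_shell {Δ a b c E h : ℚ} (hcb : c ≤ b) (ha : 0 < a) (hh : 0 ≤ h)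
    (hs : shellOK Δ a b c E h = true) {k : ℝ × ℝ} (hEk : (E : ℝ) ≤ abEnergyK (Δ : ℝ) a b c k)
    (hkE : abEnergyK (Δ : ℝ) a b c k ≤ (E : ℝ) + h) {σa σb : ℝ} (hσa0 : 0 ≤ σa)
    (hσa : σa ≤ tpHarm (halfSq k.1) (halfSq k.2)) (hσb : tpHarm (halfSq k.1) (halfSq k.2) ≤ σb) (hσb1 : σb ≤ 1) :
    shellN (Δ : ℝ) a b c E σa / shellD (Δ : ℝ) a b c E σa - shellDelta (Δ : ℝ) a b c E h ≤ abWeightK (Δ : ℝ) a b c k ∧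
    abWeightK (Δ : ℝ) a b c k ≤ shellN (Δ : ℝ) a b c E σb / shellD (Δ : ℝ) a b c E σb + shellDelta (Δ : ℝ) a b c E h := by
  obtain ⟨hDlo, hC, hE0, hF, -, -, -, -, -⟩ := shellOK_spec hs
  set x := halfSq k.1 with hx
  set y := halfSq k.2 with hy
  set ε := abEnergyK (Δ : ℝ) a b c k with hεdef
  set s := tpHarm x y with hsdef
  have hεab : ε = abBand (Δ : ℝ) a b c x y := rfl
  set t := ε - (E : ℝ) with ht
  have ht0 : 0 ≤ t := by rw [ht]; linarith
  have hth : t ≤ (h : ℝ) := by rw [ht]; linarith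
  have hhR : (0 : ℝ) ≤ h := by exact_mod_cast hh
  have hεt : ε = (E : ℝ) + t := by rw [ht]; ring
  have hs0 : 0 ≤ s := hσa0.trans hσa
  have hs1 : s ≤ 1 := hσb.trans hσb1
  have hε0 : 0 < ε := hE0.trans_le hEk
  have hP : charCubic (Δ : ℝ) a b c x y ε = 0 := by rw [hεab]; exact charCubic_abBand _ _ _ _ _ _
  have hT : 0 < fsT (Δ : ℝ) a b c ε := by rw [hεt]; exact fsT_pos_of_shift hF ht0 hth
  have hN1 : 0 < fsN1 (a : ℝ) b c ε := fsN1_pos (by exact_mod_cast hcb) hε0.le (by exact_mod_cast ha.ne')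
  have hDs : shellDlo (Δ : ℝ) a b c E h ≤ shellD (Δ : ℝ) a b c ε s := by rw [hεt]; exact shellDlo_le _ _ _ _ _ ht0 hth hs0 hs1
  have hDpos : 0 < shellD (Δ : ℝ) a b c ε s := hDlo.trans_le hDs
  have hW : 0 < dcharCubic (Δ : ℝ) a b c x y ε := by
    have e1 := fsT_mul_dcharCubic_of_contour hP
    have e2 := shellD_eq (Δ : ℝ) a b c ε s
    have : shellD (Δ : ℝ) a b c ε s = fsN1 (a : ℝ) b c ε * (fsT (Δ : ℝ) a b c ε * dcharCubic (Δ : ℝ) a b c x y ε) := by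
      rw [e2, e1]
    rw [this] at hDpos
    have h1 : 0 < fsT (Δ : ℝ) a b c ε * dcharCubic (Δ : ℝ) a b c x y ε := (mul_pos_iff_of_pos_left hN1).1 hDpos
    exact (mul_pos_iff_of_pos_left hT).1 h1
  have hw : abWeightK (Δ : ℝ) a b c k = shellN (Δ : ℝ) a b c ε s / shellD (Δ : ℝ) a b c ε s := by
    show dWeight (Δ : ℝ) a b c x y ε = _
    rw [dWeight_eq_harmonic hP hT.ne' hN1.ne' hW.ne', shellN_eq_weightHarmN, shellD_eq]
  have hTay := abs_w_sub_le_delta (Δ : ℝ) a b c (E : ℝ) hDlo ht0 hth hs0 hs1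
  rw [← hεt] at hTay
  rw [abs_le] at hTay
  have hDamin : 0 < shellDamin (Δ : ℝ) a b c E := by
    have : 0 ≤ shellDtail (Δ : ℝ) a b c E h := by
      unfold shellDtail; exact add_nonneg (Sext.absTail_nonneg _ hhR) (Sext.absTail_nonneg _ hhR)
    unfold shellDlo at hDlo; linarith
  have hlo := w_mono_s (Δ : ℝ) a b c (E : ℝ) hC hDamin hσa0 hσa hs1
  have hhi := w_mono_s (Δ : ℝ) a b c (E : ℝ) hC hDamin hs0 hσb hσb1
  rw [hw]
  constructor <;> linarith [hTay.1, hTay.2]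

/-- Integer floor division is below real division (positive divisor). [folklore] -/
theorem int_ediv_cast_le {p q : ℤ} (hq : 0 < q) : ((p / q : ℤ) : ℝ) ≤ (p : ℝ) / (q : ℝ) := by
  have hqr : (0 : ℝ) < q := by exact_mod_cast hq
  rw [le_div_iff₀ hqr]
  exact_mod_cast Int.ediv_mul_le p hq.ne'

/-- Negated floor division of the negation is above real division (positive divisor). [folklore] -/
theorem le_int_neg_ediv_cast {p q : ℤ} (hq : 0 < q) : (p : ℝ) / (q : ℝ) ≤ ((-((-p) / q) : ℤ) : ℝ) := by
  have := int_ediv_cast_le (p := -p) hq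
  push_cast at this ⊢
  rw [neg_div] at this
  linarith

/-- The scaled Möbius value: `(n₀Z·G + S·n₁Z)/(d₀Z·G + S·d₁Z) = N(E, S/G)/D(E, S/G)` and the denominator is positive. [folklore] -/
theorem moebiusZ_eq {Δ a b c E h : ℚ} (hs : shellOK Δ a b c E h = true) (hh : 0 ≤ h) {S : ℤ} (hS0 : 0 ≤ S) (hS1 : S ≤ gN) :
    0 < (shellZ Δ a b c E h).d0 * gN + S * (shellZ Δ a b c E h).d1 ∧
    (((shellZ Δ a b c E h).n0 * gN + S * (shellZ Δ a b c E h).n1 : ℤ) : ℝ) /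
      (((shellZ Δ a b c E h).d0 * gN + S * (shellZ Δ a b c E h).d1 : ℤ) : ℝ) =
      shellN (Δ : ℝ) a b c E ((S : ℝ) / 1000000000) / shellD (Δ : ℝ) a b c E ((S : ℝ) / 1000000000) := by
  obtain ⟨hDlo, -, -, -, hn0, hn1, hd0, hd1, hL⟩ := shellOK_spec hs
  have hLr : (0 : ℝ) < shellL Δ a b c E := by exact_mod_cast hL
  have hS0r : (0 : ℝ) ≤ (S : ℝ) := by exact_mod_cast hS0
  have hσ0 : (0 : ℝ) ≤ (S : ℝ) / 1000000000 := by positivity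
  have hσ1 : (S : ℝ) / 1000000000 ≤ 1 := by
    have : (S : ℝ) ≤ 1000000000 := by have := hS1; simp only [gN] at this; exact_mod_cast this
    linarith
  have hhR : (0 : ℝ) ≤ h := by exact_mod_cast hh
  have hDamin : 0 < shellDamin (Δ : ℝ) a b c E := by
    have : 0 ≤ shellDtail (Δ : ℝ) a b c E h := by
      unfold shellDtail; exact add_nonneg (Sext.absTail_nonneg _ hhR) (Sext.absTail_nonneg _ hhR)
    unfold shellDlo at hDlo; linarith
  have hD : 0 < shellD (Δ : ℝ) a b c E ((S : ℝ) / 1000000000) := hDamin.trans_le (shellDamin_le _ _ _ _ _ hσ0 hσ1)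
  have hden : (((shellZ Δ a b c E h).d0 * gN + S * (shellZ Δ a b c E h).d1 : ℤ) : ℝ) =
      (shellL Δ a b c E : ℝ) * 1000000000 * shellD (Δ : ℝ) a b c E ((S : ℝ) / 1000000000) := by
    push_cast; rw [hd0, hd1]; simp only [gN, shellD]; push_cast; ring
  have hnum : (((shellZ Δ a b c E h).n0 * gN + S * (shellZ Δ a b c E h).n1 : ℤ) : ℝ) =
      (shellL Δ a b c E : ℝ) * 1000000000 * shellN (Δ : ℝ) a b c E ((S : ℝ) / 1000000000) := by
    push_cast; rw [hn0, hn1]; simp only [gN, shellN]; push_cast; ring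
  have hdenpos : (0 : ℝ) < (((shellZ Δ a b c E h).d0 * gN + S * (shellZ Δ a b c E h).d1 : ℤ) : ℝ) := by
    rw [hden]; positivity
  refine ⟨by exact_mod_cast hdenpos, ?_⟩
  rw [hden, hnum, mul_div_mul_left _ _ (by positivity)]

/-- `⌈δ·W⌉ ≥ W·δ` on the real side. [folklore] -/
theorem shellZ_dl_ge (Δ a b c E h : ℚ) : 100000 * shellDelta (Δ : ℝ) a b c E h ≤ ((shellZ Δ a b c E h).dl : ℝ) := by
  have h1 := Int.le_ceil (shellDelta Δ a b c E h * wW)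
  have h' : ((shellDelta Δ a b c E h * wW : ℚ) : ℝ) ≤ ((⌈shellDelta Δ a b c E h * wW⌉ : ℤ) : ℝ) := by exact_mod_cast h1
  rw [Rat.cast_mul, cast_shellDelta] at h'
  have hw : (((wW : ℤ) : ℚ) : ℝ) = 100000 := by norm_num [wW]
  rw [hw] at h'
  show 100000 * shellDelta (Δ : ℝ) a b c E h ≤ ((⌈shellDelta Δ a b c E h * wW⌉ : ℤ) : ℝ)
  linarith

/-- **`wLoZ` IS A LOWER BOUND**: `wLoZ/W ≤ N/D(E, S/G) − δ`. [folklore] -/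
theorem wLoZ_sound {Δ a b c E h : ℚ} (hs : shellOK Δ a b c E h = true) (hh : 0 ≤ h) {S : ℤ} (hS0 : 0 ≤ S) (hS1 : S ≤ gN) :
    ((wLoZ (shellZ Δ a b c E h) S : ℤ) : ℝ) ≤
      100000 * (shellN (Δ : ℝ) a b c E ((S : ℝ) / 1000000000) / shellD (Δ : ℝ) a b c E ((S : ℝ) / 1000000000)
        - shellDelta (Δ : ℝ) a b c E h) := by
  obtain ⟨hpos, heq⟩ := moebiusZ_eq hs hh hS0 hS1
  set num := (shellZ Δ a b c E h).n0 * gN + S * (shellZ Δ a b c E h).n1 with hnum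
  set den := (shellZ Δ a b c E h).d0 * gN + S * (shellZ Δ a b c E h).d1 with hden
  have h1 := int_ediv_cast_le (p := num * wW) hpos
  have hdl := shellZ_dl_ge Δ a b c E h
  have hdenr : (0 : ℝ) < (den : ℝ) := by exact_mod_cast hpos
  have e : ((num * wW : ℤ) : ℝ) / (den : ℝ) =
      100000 * (shellN (Δ : ℝ) a b c E ((S : ℝ) / 1000000000) / shellD (Δ : ℝ) a b c E ((S : ℝ) / 1000000000)) := by
    rw [← heq]; push_cast; simp only [wW]; push_cast; field_simp
  rw [e] at h1
  unfold wLoZ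
  push_cast at h1 ⊢
  linarith

/-- **`wHiZ` IS AN UPPER BOUND**: `N/D(E, S/G) + δ ≤ wHiZ/W`. [folklore] -/
theorem wHiZ_sound {Δ a b c E h : ℚ} (hs : shellOK Δ a b c E h = true) (hh : 0 ≤ h) {S : ℤ} (hS0 : 0 ≤ S) (hS1 : S ≤ gN) :
    100000 * (shellN (Δ : ℝ) a b c E ((S : ℝ) / 1000000000) / shellD (Δ : ℝ) a b c E ((S : ℝ) / 1000000000)
        + shellDelta (Δ : ℝ) a b c E h) ≤ ((wHiZ (shellZ Δ a b c E h) S : ℤ) : ℝ) := by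
  obtain ⟨hpos, heq⟩ := moebiusZ_eq hs hh hS0 hS1
  set num := (shellZ Δ a b c E h).n0 * gN + S * (shellZ Δ a b c E h).n1 with hnum
  set den := (shellZ Δ a b c E h).d0 * gN + S * (shellZ Δ a b c E h).d1 with hden
  have h1 := le_int_neg_ediv_cast (p := num * wW) hpos
  have hdl := shellZ_dl_ge Δ a b c E h
  have hdenr : (0 : ℝ) < (den : ℝ) := by exact_mod_cast hpos
  have e : ((num * wW : ℤ) : ℝ) / (den : ℝ) =
      100000 * (shellN (Δ : ℝ) a b c E ((S : ℝ) / 1000000000) / shellD (Δ : ℝ) a b c E ((S : ℝ) / 1000000000)) := by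
    rw [← heq]; push_cast; simp only [wW]; push_cast; field_simp
  rw [e] at h1
  unfold wHiZ
  push_cast at h1 ⊢
  linarith

end Summit.Ventures.CertifiedManyBodySolver.Downfold.Emery
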